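import Literature.Geometry.Kaehler.ComplexTorusHodgeDecomposition
import Literature.NumberTheory.Transcendental.ComplexFormsMixedType
import Literature.NumberTheory.Transcendental.ComplexFormsProofs
import Literature.NumberTheory.Transcendental.FormsAlgebraWedgeProofs
import HarnessLib

/-!
# Pointwise `(p,q)`-types: wedge products and vanishing above the dimension

Topic: linear algebra of `(p,q)`-types on a complex vector space `E` (Voisin (2002), §2.3.1),
pointwise companion of `PQTypes.lean` / `ComplexFormsMixedType.lean`. Theorems only, no new facts.

* `IsOfTypeAt.wedge` — types add under `∧` (pointwise form of `IsOfType.wedge_holds`).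
* `IsOfTypeAt.eq_zero_of_finrank_lt_fst` — a form of pointwise type `(p,q)` with `p > dim_ℂ E`
  vanishes (`eq_zero_of_weight_of_finrank_lt_fst`).
* `wedge_eq_zero_of_typeProjAt_eq_zero` — **the Hodge-filtration vanishing**: if
  `η₁ ∈ F^{n-p₀+1}` (all components `(a,b)` with `a + p₀ ≤ n = dim_ℂ E` vanish) and `η₂ ∈ F^{p₀}`
  (all components `(r,s)` with `r < p₀` vanish), then `η₁ ∧ η₂ = 0` — every component of the
  product has first type index `> n`. This is the pointwise reason for
  `F^{n-p+1}H^{2n-k} ∧ F^pH^k = 0`, Voisin (2002), §7.1.2 / proof of Thm. 10.9.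

## References

* C. Voisin, *Hodge Theory and Complex Algebraic Geometry I*, CUP (2002), §2.3.1, Rem. 2.24,
  §7.1.2. [VoisinHodgeI2002]
-/

noncomputable section

open scoped Manifold ComplexConjugate
open Complex Finset
open Literature.NumberTheory.Transcendental Literature.Geometry.Kaehler

namespace Literature.Analysis.Complex

variable {E : Type*} [NormedAddCommGroup E] [NormedSpace ℂ E] {k l : ℕ}

/-- **Types add under the wedge product** (pointwise form of the tree's `IsOfType.wedge_holds`):
`η₁` of type `(p,q)` and `η₂` of type `(p',q')` give `η₁ ∧ η₂` of type `(p+p', q+q')`.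
[cite: Voisin2002, §2.3.1 eq. (2.4)] -/
theorem IsOfTypeAt.wedge {p q p' q' : ℕ} {η₁ : E [⋀^Fin k]→L[ℝ] ℂ} {η₂ : E [⋀^Fin l]→L[ℝ] ℂ}
    (h₁ : IsOfTypeAt p q η₁) (h₂ : IsOfTypeAt p' q' η₂) :
    IsOfTypeAt (p + p') (q + q') (η₁.wedge η₂) := by
  have h := IsOfType.wedge_holds (E := E) (M := E) (k := k) (l := l)
    ((isOfType_const_iff p q η₁).2 h₁) ((isOfType_const_iff p' q' η₂).2 h₂)
  exact (isOfType_const_iff _ _ _).1 h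

/-- **No non-zero forms of pointwise type `(p,q)` with `p > dim_ℂ E`** (pointwise
`eq_zero_of_weight_of_finrank_lt_fst`; Voisin (2002), Rem. 2.24). [cite: VoisinHodgeI2002, §2.3.1] -/
theorem IsOfTypeAt.eq_zero_of_finrank_lt_fst [FiniteDimensional ℂ E] {p q : ℕ}
    {η : E [⋀^Fin k]→L[ℝ] ℂ} (h : IsOfTypeAt p q η) (hp : Module.finrank ℂ E < p) : η = 0 :=
  eq_zero_of_weight_of_finrank_lt_fst h.1 η (fun θ v ↦ h.2 θ v) hp

/-- **Hodge-filtration vanishing of wedge products, pointwise.** Let `n = dim_ℂ E`. If every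
`(a,b)`-component of `η₁` with `a + p₀ ≤ n` vanishes (`η₁ ∈ F^{n-p₀+1}`) and every
`(r,s)`-component of `η₂` with `r < p₀` vanishes (`η₂ ∈ F^{p₀}`), then `η₁ ∧ η₂ = 0`: expanding
both in components, each surviving product `η₁^{a,b} ∧ η₂^{r,s}` has type `(a + r, b + s)` with
`a + r > n` and vanishes. Voisin (2002), §7.1.2 (the pairing `F^pH^k ⊗ F^{n-p+1}H^{2n-k} → 0`),
proof of Thm. 10.9. [cite: VoisinHodgeI2002, §7.1.2] -/
theorem wedge_eq_zero_of_typeProjAt_eq_zero [FiniteDimensional ℂ E] {p₀ : ℕ}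
    {η₁ : E [⋀^Fin k]→L[ℝ] ℂ} {η₂ : E [⋀^Fin l]→L[ℝ] ℂ}
    (h₁ : ∀ a b, a + p₀ ≤ Module.finrank ℂ E → typeProjAt a b η₁ = 0)
    (h₂ : ∀ r s, r < p₀ → typeProjAt r s η₂ = 0) :
    η₁.wedge η₂ = 0 := by
  classical
  -- expand both factors in components and use bilinearity through `wedgeCLM`
  have hbil : η₁.wedge η₂ = wedgeCLM ℝ E ℂ k l η₁ η₂ := rfl
  rw [hbil, ← sum_antidiagonal_typeProjAt η₁, ← sum_antidiagonal_typeProjAt η₂, map_sum]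
  refine Finset.sum_eq_zero fun rs hrs ↦ ?_
  rw [map_sum, _root_.sum_apply]
  refine Finset.sum_eq_zero fun ab hab ↦ ?_
  rw [wedgeCLM_apply]
  rw [mem_antidiagonal] at hab hrs
  -- case analysis on the type indices
  by_cases ha : ab.1 + p₀ ≤ Module.finrank ℂ E
  · rw [h₁ ab.1 ab.2 ha, ContinuousAlternatingMap.zero_wedge]
  by_cases hr : rs.1 < p₀
  · rw [h₂ rs.1 rs.2 hr, ContinuousAlternatingMap.wedge_zero]
  · have ht : IsOfTypeAt (ab.1 + rs.1) (ab.2 + rs.2)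
        ((typeProjAt ab.1 ab.2 η₁).wedge (typeProjAt rs.1 rs.2 η₂)) :=
      (isOfTypeAt_typeProjAt hab η₁).wedge (isOfTypeAt_typeProjAt hrs η₂)
    exact ht.eq_zero_of_finrank_lt_fst (by omega)

end Literature.Analysis.Complex
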